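import Mathlib
import Summits.CriticalPhenomena.SAWScalingLimit.Theses.SAWDefectDecoherence
import Literature.Barriers.CriticalPhenomena.ParafermionicHalfCauchyRiemann

/-!
# Sketch — crux-ideate stmt-CriticalPhenomena-14003 (HexObservableLimitR), round 1, ideator 2

First lemmas of the two idea cards (statements only; the `theorem`s below are fully proved
consequences of tree facts, everything else is a `def … : Prop`).

* Card A `far-root-flat-layer-chirality`: `slabFlux_eq_zero` (exact flux conservation through any
  vertex subset, from DCS Lemma 1 — the row-by-row transport of the `b`-normalisation),
  `observable_reversal` statement `ObservableReversal`, the half-lattice boxes `halfBox`, far roots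
  `farRoot`, and the positive-mass statement `TargetForgetting`.
* Card B `weak-curl-exact-interior`: `WeakCurlFree` (the crux restricted to `ψ = ∂̄χ`) and the
  real-analysis hinge `DbarAgainstHolomorphic` (provable now) making it a special case of the crux.
-/

noncomputable section

namespace Summit.CriticalPhenomena.SAWScalingLimit.Cruxes.HexObservableLimitR.Ideator2

open Literature.Probability.RandomPlanarGeometry Literature.Probability.RandomPlanarGeometry.SAW
open Literature.Probability.LatticeModels Literature.Barriers.CriticalPhenomena
open scoped BigOperators Topology

/-- Shorthand: the critical `σ = 5/8` observable of the domain `Λ` rooted at `a`. -/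
def Fobs (Λ : Finset HexVertex) (a : Sym2 HexVertex) : Sym2 HexVertex → ℂ :=
  hexParafermionicObservable Λ a hexCriticalFugacity (5 / 8)

/-- Shorthand: the `σ = 0` observable = the positive `x_c`-mass `Z_Λ(a → z)`. -/
def Zmass (Λ : Finset HexVertex) (a : Sym2 HexVertex) : Sym2 HexVertex → ℂ :=
  hexParafermionicObservable Λ a hexCriticalFugacity 0

/-! ### Card A — exact flux transport and the far-root flat boundary layer -/

/-- **Exact slab flux (card A, first lemma, PROVED from tree facts).** For every simply connected
`Λ`, boundary root `a` and EVERY vertex subset `S ⊆ Λ`, the flux of the critical observable out of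
`S` vanishes. With `S` = the vertices of the exact half-lattice ball below row `j`, this is the
row-by-row conservation of the window sum of `F` over vertical edges: the `b`-normalisation is
transported EXACTLY from the wall (row `m₁(δ)`) to any height. -/
theorem slabFlux_eq_zero (h : DuminilCopinSmirnov2012_lemma1) (Λ : Finset HexVertex)
    (hΛ : hexDomainSimplyConnected Λ) (a : Sym2 HexVertex) (ha : a ∈ hexDomainBoundary Λ)
    (S : Finset HexVertex) (hS : S ⊆ Λ) :
    HexGreen.hexFlux S (Fobs Λ a) = 0 := by
  have hrel : SatisfiesVertexRelations Λ (Fobs Λ a) := by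
    simpa [Fobs, hexCriticalFugacity] using (lemma1_iff.mp h) Λ hΛ a ha
  exact (ParafermionicHalfCauchyRiemannNarrow Λ (Fobs Λ a)).1 hrel S hS

/-- **Reversal symmetry (card A/C support, provable now: reverse `verts`, `W ↦ -W`).** For two
mid-edges of the domain the observable from `b` to `a` is the complex conjugate of the observable
from `a` to `b` (any real fugacity and spin). In particular `Z_Λ(a→b) = Z_Λ(b→a)` and
`|F^a(b)| = |F^b(a)|`. -/
def ObservableReversal : Prop :=
  ∀ (Λ : Finset HexVertex) (a b : Sym2 HexVertex), a ∈ hexDomainMidEdges Λ →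
    b ∈ hexDomainMidEdges Λ → ∀ x σ : ℝ,
      hexParafermionicObservable Λ b x σ a = (starRingEnd ℂ) (hexParafermionicObservable Λ a x σ b)

/-- The lattice point `(i, j) ∈ ℤ²`. -/
def pt (i j : ℤ) : Site 2 := ![i, j]

/-- The half-lattice box `{(p, s) : -n ≤ p₀ ≤ n, 0 ≤ p₁ ≤ n}` (rows `p₁ ≥ 0`: the exact
half-lattice of the crux's rigid balls, truncated). -/
def halfBox (n : ℕ) : Finset HexVertex :=
  (((Finset.Icc (-(n : ℤ)) n) ×ˢ (Finset.Icc (0 : ℤ) n)).image fun p => pt p.1 p.2) ×ˢ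
    (Finset.univ : Finset (Fin 2))

/-- The vertical dangling edge below the up-face of the cell `(i, 0)`: a boundary mid-edge of the
flat wall of `halfBox n` (the up face `(y,0)` is adjacent to the down face `(y - e₁, 1)`). -/
def wallEdge (i : ℤ) : Sym2 HexVertex :=
  s((pt i 0, (0 : Fin 2)), (pt i (-1), (1 : Fin 2)))

/-- A far root on the wall: column `-⌊n/2⌋` (left) or `+⌊n/2⌋` (right). -/
def farRoot (n : ℕ) (left : Bool) : Sym2 HexVertex :=
  wallEdge (if left then -((n / 2 : ℕ) : ℤ) else ((n / 2 : ℕ) : ℤ))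

/-- **TargetForgetting (card A, the positive-mass input).** The ARRIVAL-RATIO PROFILE near the
origin of the wall, seen from a far root, has a limit that does not remember on which side the
root was: for mid-edges `e, e'` near the origin, `Z(a_n → e)/Z(a_n → e')` converges to the same
`R(e,e')` for the far-left and the far-right roots. By `ObservableReversal` this is a statement
about the INITIAL segment of long wall-to-wall arcs (ratio of partition functions with far
targets) — positive masses only, no winding phase, immune to the `δ^{25/48}` cancellation wall. -/
def TargetForgetting : Prop :=
  ∀ e e' : Sym2 HexVertex, (∃ n₀ : ℕ, ∀ n ≥ n₀, e ∈ hexDomainMidEdges (halfBox n) ∧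
      e' ∈ hexDomainMidEdges (halfBox n)) →
    ∃ R : ℂ, R ≠ 0 ∧
      Filter.Tendsto (fun n : ℕ => Zmass (halfBox n) (farRoot n true) e /
          Zmass (halfBox n) (farRoot n true) e') Filter.atTop (𝓝 R) ∧
      Filter.Tendsto (fun n : ℕ => Zmass (halfBox n) (farRoot n false) e /
          Zmass (halfBox n) (farRoot n false) e') Filter.atTop (𝓝 R)

/-- **FarRootProfile (card A, what the crux needs at its pins).** The complex observable near the
origin of the wall, normalised at the wall edge `wallEdge 0`, converges for far roots to a `δ`-free
BOUNDARY-LAYER PROFILE `U e`, the same from the left and from the right up to complex conjugation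
composed with the wall reflection (here only existence + side-independence of the modulus is
recorded). Card A: flux transport forces `U` on vertical edges to be constant in the height, and
`c(14003) = 2√3 · lim_height (class average of U)`. -/
def FarRootProfile : Prop :=
  ∀ e : Sym2 HexVertex, (∃ n₀ : ℕ, ∀ n ≥ n₀, e ∈ hexDomainMidEdges (halfBox n)) →
    ∃ U : ℂ, ∀ left : Bool,
      Filter.Tendsto (fun n : ℕ => ‖Fobs (halfBox n) (farRoot n left) e /
          Fobs (halfBox n) (farRoot n left) (wallEdge 0)‖) Filter.atTop (𝓝 ‖U‖)

/-! ### Card B — the exact interior content of the typed crux -/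

/-- The Wirtinger derivative `∂̄χ = (∂ₓχ + i ∂_yχ)/2` of a real-differentiable `χ : ℂ → ℂ`. -/
def dbar (χ : ℂ → ℂ) (z : ℂ) : ℂ :=
  (fderiv ℝ χ z 1 + Complex.I * fderiv ℝ χ z Complex.I) / 2

/-- **DbarAgainstHolomorphic (card B, first lemma, provable now — integration by parts).**
For `g` holomorphic on an open set `U` and `χ ∈ C²_c(U)`, `∫ ∂̄χ · g = 0`. With
`g = exp((5/8)(L - L_b))` this shows that the crux's right-hand side VANISHES on every test function
`ψ = ∂̄χ`, so `WeakCurlFree` below is literally a special case of `HexObservableLimitR`. -/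
def DbarAgainstHolomorphic : Prop :=
  ∀ (U : Set ℂ), IsOpen U → ∀ (g χ : ℂ → ℂ), DifferentiableOn ℂ g U → ContDiff ℝ 2 χ →
    HasCompactSupport χ → tsupport χ ⊆ U → ∫ z, dbar χ z * g z = 0

/-- **WeakCurlFree (card B): the typed crux restricted to `∂̄`-exact test functions.** Same
hypotheses as `HexObservableLimitR` (stmt-CriticalPhenomena-14003) verbatim; the test function is
`ψ = ∂̄χ`, `χ ∈ C²_c(Ω)`, and the conclusion is that the normalised smeared observable tends to `0`
(no constant `c`, no conformal map in the conclusion). Card B: this is EXACTLY the interior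
(half-of-Cauchy–Riemann) content of 14003 — plain `ψ`-averages only see the class average `Ã` of
the observable, the vertex relation gives `∂̄Ã + ∂B̃ = 0` for the alias mode `B̃`, and
`WeakCurlFree ⇔ ∂̄Ã = 0 ⇔ ∂B̃ = 0 ⇔` hexagon circulations `→ 0` weakly; `B̃ = 0` is NOT required. -/
def WeakCurlFree : Prop :=
  ∀ (D : Literature.Probability.RandomPlanarGeometry.DobrushinDomain) (ρ : ℝ)
    (Λ : ℝ → Finset Literature.Probability.LatticeModels.HexVertex) (m : Fin 2 → ℝ → ℤ)
    (a b : ℝ → Sym2 Literature.Probability.LatticeModels.HexVertex)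
    (Φ : Literature.Probability.RandomPlanarGeometry.ConformalEquiv D.carrier
      UpperHalfPlane.upperHalfPlaneSet) (χ : ℂ → ℂ),
    let F : ℝ → Sym2 Literature.Probability.LatticeModels.HexVertex → ℂ := fun δ z =>
      Literature.Probability.RandomPlanarGeometry.SAW.hexParafermionicObservable (Λ δ) (a δ)
        Literature.Probability.RandomPlanarGeometry.SAW.hexCriticalFugacity (5 / 8) z
    0 < ρ →
    (∀ i : Fin 2, D.carrier ∩ Metric.ball (D.pt i) ρ =
      {z : ℂ | (D.pt i).im < z.im} ∩ Metric.ball (D.pt i) ρ) →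
    (∀ᶠ δ : ℝ in nhdsWithin 0 (Set.Ioi 0),
      Literature.Probability.RandomPlanarGeometry.SAW.hexDomainSimplyConnected (Λ δ) ∧
      a δ ∈ Literature.Probability.RandomPlanarGeometry.SAW.hexDomainBoundary (Λ δ) ∧
      b δ ∈ Literature.Probability.RandomPlanarGeometry.SAW.hexDomainBoundary (Λ δ) ∧
      Nonempty (Literature.Probability.RandomPlanarGeometry.SAW.HexMidEdgeSAW (Λ δ) (a δ) (b δ)) ∧
      (Literature.Probability.LatticeModels.hexGraph.induce
        ((Λ δ : Finset Literature.Probability.LatticeModels.HexVertex) :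
          Set Literature.Probability.LatticeModels.HexVertex)).Preconnected ∧
      (∀ v ∈ Λ δ, (δ : ℂ) * Literature.Probability.LatticeModels.hexCenter v ∈ D.carrier) ∧
      (∀ i : Fin 2, ∀ v : Literature.Probability.LatticeModels.HexVertex,
        (δ : ℂ) * Literature.Probability.LatticeModels.hexCenter v ∈ Metric.ball (D.pt i) ρ →
          (v ∈ Λ δ ↔ m i δ ≤ v.1 1))) →
    (∀ K : Set ℂ, IsCompact K → K ⊆ D.carrier → ∀ᶠ δ : ℝ in nhdsWithin 0 (Set.Ioi 0),
      ∀ v : Literature.Probability.LatticeModels.HexVertex,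
        (δ : ℂ) * Literature.Probability.LatticeModels.hexCenter v ∈ K → v ∈ Λ δ) →
    Filter.Tendsto (fun δ : ℝ => (δ : ℂ) *
      Literature.Probability.RandomPlanarGeometry.SAW.hexMidpoint (a δ))
      (nhdsWithin 0 (Set.Ioi 0)) (nhds (D.pt 0)) →
    Filter.Tendsto (fun δ : ℝ => (δ : ℂ) *
      Literature.Probability.RandomPlanarGeometry.SAW.hexMidpoint (b δ))
      (nhdsWithin 0 (Set.Ioi 0)) (nhds (D.pt 1)) →
    Filter.Tendsto (fun x => ‖Φ x‖) (nhdsWithin (D.pt 0) D.carrier) Filter.atTop →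
    Φ.HasBoundaryValue (D.pt 1) 0 →
    ContDiff ℝ 2 χ → HasCompactSupport χ → tsupport χ ⊆ D.carrier →
    Filter.Tendsto (fun δ : ℝ => (δ : ℂ) ^ 2 *
      (∑ᶠ e ∈ Literature.Probability.RandomPlanarGeometry.SAW.hexDomainMidEdges (Λ δ),
        dbar χ ((δ : ℂ) * Literature.Probability.RandomPlanarGeometry.SAW.hexMidpoint e) * F δ e) /
        F δ (b δ)) (nhdsWithin 0 (Set.Ioi 0)) (nhds 0)

/-- Sanity: the crux's own decl is in scope (the parent statement this card reshapes). -/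
example : Prop := Summit.CriticalPhenomena.SAWScalingLimit.Theses.SAWDefectDecoherence.HexObservableLimitR

end Summit.CriticalPhenomena.SAWScalingLimit.Cruxes.HexObservableLimitR.Ideator2
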